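import Literature.MathematicalPhysics.QuantumFieldTheory.Balaban1983to89.B9Thm39Sum
import Literature.MathematicalPhysics.QuantumFieldTheory.Balaban1983to89.B9Cor38Whole

/-!
# `Balaban1983to89.B9Thm39Whole` — [B9] Theorem 3.9 (p. 413) AS THE WHOLE PRINTED LEAF `B9.Thm39Printed` at a PINNED
# kernel expansion datum `EK39OfOps`, and the kernel-summation leaf `B9.RWKernelSumYields` ("This theorem implies Theorem 3.2")
# at the same datum — a glue module over the landed lineage `B9Thm39Sum` ((3.95)–(3.96), (3.99), (3.48))

T. Bałaban, *Propagators for lattice gauge theories in a background field*, Commun. Math. Phys. **99** (1985) 389–434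
[`Balaban1985BackgroundPropagators`, "B9"]; [4] = T. Bałaban, *Propagators and renormalization transformations for lattice
gauge theories. II*, Commun. Math. Phys. **96** (1984) 223–250 [`Balaban1984PropagatorsII`].

statement-level skeleton of published theorems with citation tags; proofs where landed; nothing here is a claim about the
Yang–Mills mass gap

THE PRINTED LOCI (verbatim).  p. 411: *"Next let us consider the operator (Q′G′²Q′\*)⁻¹. We will find an expansion of this
operator as usual considering Q′G′²Q′\*C₀. We write it in the same way as in (2.82) [4]: Q′G′²Q′\*C₀ = I + Σ_□(1 − □̃)Q′G′²Q′\*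
h_□C_□h_□ + Σ_□ □̃Q′(G′² − G′²_□)Q′\*h_□C_□h_□ + Σ_□[□̃Q′G′²_□Q′\*, h_□]C_□h_□ = I − R (3.95).  By the same estimates as in [4],
especially (2.83)–(2.85), we can see that the operator R is small and (Q′G′²Q′\*)⁻¹ = C₀(I − R)⁻¹ = Σ_{n=0}^∞ C₀Rⁿ (3.96).  The
series is convergent in the weighted supremum norm on 𝔅 appearing in the inequality (3.48) in Theorem 3.2."*;  p. 413: *"We
denote a factor by R′_α(X). We assume that 0 is a possible value of the index α, and that R′₀(□) = h_□C_□h_□, R′₀(X) = 0 for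
localization domains bigger than a cube from 𝒟. […] An operator R(X) has the following important properties: it is
localized in X, i.e. its kernel has a support in X × X, it depends on U restricted to X̃⁵, and satisfies a bound of the type
(3.89), possibly with an additional power of L^jη. It is difficult to make the last statement more precise. Instead we will
write a bound for a whole term in the expansion.  Theorem 3.9. For M sufficiently large, and a configuration U satisfying
(3.35), the operator Q′G′²Q′\* has an inverse which can be represented as (Q′G′²Q′\*)⁻¹ = Σ_ω R′₀(X₀)R′_{α₁}(X₁)·⋯·R′_{αₙ}(Xₙ)
(3.98) […] A term in this expansion corresponding to a walk ω depends on U restructed [sic] to X̃⁵₀ ∪ X̃⁵₁ ∪ … ∪ X̃⁵ₙ, and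
has the following bound: |(R′₀(X₀)R′_{α₁}(X₁)·⋯·R′_{αₙ}(Xₙ))(y, y′)| ≦ O(1)(L^jη)^{−4}(L^{j′}η)^{−d}O(M^{−1/2})^{|ω|}M^{−½|ω|}
e^{−½δ₀d(ω,y,y′)}, y ∈ Λ_j, y′ ∈ Λ_{j′} (3.99).  The distance d(ω, y, y′) is defined by (3.93), but the infimum is taken over
yᵢ ∈ Xᵢ ∩ 𝔅. […] This theorem implies Theorem 3.2."*

THE POINT.  The cell's typed skeleton `…Balaban1983to89.B9` carries Theorem 3.9 as ONE predicate `B9.Thm39Printed d c35 geo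
bg E` over ABSTRACT kernel-expansion data `E : ∀ i, B9.RWKernelExpansion (geo i) (bg i)` (walks, |ω|, d(ω, y, y′), the
kernel of the ω-term, a U-localisation clause, and an arbitrary predicate `Converges`), and the step *"This theorem implies
Theorem 3.2"* as the by-reference leaf `B9.RWKernelSumYields d geo bg E Cinv` (convergence ⇒ the kernel bound (3.48) for
`Cinv`).  The N06 knit at the record (`BalabanUVNodesN06AtRecord11CB10YZW.b9_main_of_up_view₁₁B10YZW_of_obligations`)
consumes both only as hypotheses `t39`, `hksum`.  Meanwhile the lineage `B9Thm39Sum` PROVES, at the kernel level on the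
finite set 𝔅, (3.95) as a ring identity (`eq395_oneSub`), (3.96) ⇒ (3.48) with the smallness and the constants explicit
(`inverse_kernel_348_of_395`), and the (3.99)-shape bound of a walk term from factor majorants (`term399_majorant`) — but no
theorem concludes the leaves themselves.  THIS FILE is that glue, in the pattern of `B9Thm37Whole` ∕ `B9Cor38Whole`:

* §1 `Ops39 g B ι κ` — the operator letters of (3.87), (3.95), (3.98) at ONE family member as functions of U, on the
  functions on the finite set 𝔅 = `g.Site` (L(U) = Q′G′²Q′\*, L_□ = Q′G′²_□Q′\*, C_□(U), the walk factors R′_α(X), α ≠ 0) with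
  the partition data {h_□}, □̃, S_□ and the localisation sets X ∩ 𝔅 — a PARAMETER RECORD; `C0`, `Rop` = C₀ of (3.87) and R
  of (3.95) SPELLED from the letters; `Conv348 𝔬 d B₁ δ₁ U` = «L(U) has a two-sided inverse whose kernel w.r.t. the pairing
  weight (L^{j′}η)^d obeys (3.48) with constants (B₁, δ₁)» — the typed reading of (3.96) *"convergent in the weighted supremum
  norm on 𝔅 appearing in the inequality (3.48)"*; `EK39OfOps 𝔬 rd d B₁ δ₁ : B9.RWKernelExpansion g B` — EVERY field pinned:
  walks (n, □₀, (α_k, X_k)_k), |ω| = n, d(ω, y, y′) = `B9Cor38Whole.minLen` over X_k ∩ 𝔅, the ω-term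
  h_{□₀}C_{□₀}h_{□₀}·R′_{α₁}(X₁)⋯R′_{αₙ}(Xₙ) read through its kernel `B9Thm34Inv.ker (vol g d)`, the localisation clause read as
  «the term at U equals the term at every U′ coinciding with U on □̃⁵₀, X̃⁵₁, …, X̃⁵ₙ», `Converges := Conv348`.
* §2 the hypothesis schemas (printed shape; nothing asserted): `StaticOK39` (metric facts, L^jη > 0, |h_□| ≦ 1, supp h_□ ∩ 𝔅
  ⊂ S_□, Σ_□h_□² = 1, □̃h_□ = h_□, overlaps ≦ N), `Local348` ((3.48) for every C_□(U) — p. 409 *"satisfy all the inequalities of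
  Theorems 3.1–3.3"*), `Identities395` (C_□ = (Q′G′²_□Q′\*)⁻¹), `Small285` (the (2.85)-shape kernel bound of R with its O(M⁻¹)
  — *"By the same estimates as in [4], especially (2.83)–(2.85)"*, BY REFERENCE exactly as the lineage's `hRk`; cell GAPS
  G-B9-05 ∕ G-B9-07), `Factors389` (the (3.89)-type bound of the factors R′_α(X), α ≠ 0, localized in X), `Locality39`.
* §3 one member, one U: `L_mul_C0_eq` ((3.95): L·C₀ = I − R), `conv348_of_local348` ((3.96) ⇒ (3.48) with B₁ = 2NB₀c₁(r, α′),
  δ₁ = (1 − α′)r under the LOCATED threshold M ≧ 2θ₀c₁(r, α′)), `locDep_EK39OfOps`, `kterm_EK39OfOps_le` ((3.99) with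
  O(1) = B₀, O(M^{−1/2}) = (θ₀c₁(α) + 1)M^{−1/2}, rate ½·2(1 − α)δ₀).
* §4 ★ `thm39Printed_of_local348` — **THE WHOLE PRINTED LEAF** `B9.Thm39Printed d c35 geo bg (fun i => EK39OfOps …)` under the
  printed provisos (M ≧ M₂ := max(M₁, M_L, 2θ₀c₁(r, α′)), 0 < α₀, Mα₀ ≦ a₁∕O(1), (3.35)).
* §5 row `hksum`: `KerReads` (the kernel letter `Cinv` of the carriers READS the inverse of L(U)), `rwKernelSumYields_of_conv348`,
  ★ `rwKernelSumYields_EK39OfOps` — `B9.RWKernelSumYields d geo bg (fun i => EK39OfOps …) Cinv`, and `thm32Printed_EK39OfOps`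
  (*"This theorem implies Theorem 3.2"*, by the cell's `B9.thm32_of_thm39`).

HONEST SCOPE.  Nothing of print is asserted: (3.48) for the C_□, the local inverse identities, the smallness of R (the
second and third sums of (3.95) rest on (3.97) from [2] and the commutator estimate — not reproduced anywhere in the tree),
the factor bounds, the locality inputs, [4] Lemma 2.1 (2.61) and the metric facts are HYPOTHESES of printed shape; the
re-expansion of pp. 411–412 turning Σ C₀Rⁿ into the walk sum (3.98) is not reproduced (the two parts of the typed leaf —
`Converges` and the term bounds — are supplied independently, as the typed sentence allows); heteromorphic factors (*"act
between different scales"*, p. 413) and the *"additional power of L^jη"* are not modelled (all letters act on the functions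
on 𝔅); the head index X₀ is read as a cube □₀ ∈ 𝒟 (print: R′₀(X) = 0 otherwise, so nothing is lost).  Value: kernel-checked
bookkeeping — the printed leaves inhabited over the lineage's objects — NOT a node discharge, NOT summit progress; nothing
continuum, nothing about the mass gap.  Cell `pub-ymgap` (HUMAN RULING D-0062), Track A node N06 [B9], seat
`pub-ymgap-dag-n06-j` (N06-ASSIGNMENT v1 rows 15–16), 2026-08-26.
-/

namespace Literature.MathematicalPhysics.QuantumFieldTheory.Balaban1983to89.B9Thm39Whole

open Literature.MathematicalPhysics.QuantumFieldTheory.Balaban1983to89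
open Finset B6RandomWalk B9Thm37Sum B9Thm34Ext B9Thm34Inv B9Thm39Sum B9Cor38Whole

noncomputable section

/-! ## §1 The letters of (3.87), (3.95), (3.98) at one member; C₀ and R; the convergence content; the datum `EK39OfOps` -/

section OneMember

variable {g : B9.Geometry} [Fintype g.Site] [DecidableEq g.Site] {B : B9.Backgrounds} {ι κ : Type}

/-- **THE LETTERS OF (3.87), (3.95) AND (3.98) AT ONE FAMILY MEMBER**, as total functions of the background configuration U,
acting on the functions on the finite set 𝔅 = `g.Site` (the paper's lattices are finite tori; kernels "(y, y′), y ∈ Λ_j, y′ ∈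
Λ_{j′}" are read through `B9Thm34Inv.ker (B9Thm34Inv.vol g d)`).  Over the cube index `ι` = 𝒟 (p. 408): `S □` = the sites of 𝔅
whose blocks meet supp h_□, `h □` = h_□ read on 𝔅, `chi □` = the characteristic function □̃ read on 𝔅; `L U` = Q′(U)G′²(U)Q′\*(U),
`Lloc U □` = Q′G′²_□Q′\*, `Cl U □` = C_□(U) (p. 409: *"C_□(U) = (Q′(U)G′²_□(U)Q′\*(U))⁻¹"*).  Over the factor index `κ` = the pairs
(α, X), α ≠ 0 (p. 413): `Sw c` = X ∩ 𝔅, `Rw U c` = R′_α(X).  A PARAMETER RECORD — nothing is constructed or asserted (pattern of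
`B9Thm37Whole.Ops`). [cite: Balaban1985BackgroundPropagators, (3.87) p.409 + (3.95) p.411 + (3.98) p.413] -/
structure Ops39 (g : B9.Geometry) (B : B9.Backgrounds) (ι κ : Type) where
  S : ι → Finset g.Site
  h : ι → g.Site → ℝ
  chi : ι → g.Site → ℝ
  L : B.Cfg → Module.End ℝ (g.Site → ℝ)
  Lloc : B.Cfg → ι → Module.End ℝ (g.Site → ℝ)
  Cl : B.Cfg → ι → Module.End ℝ (g.Site → ℝ)
  Sw : κ → Finset g.Site
  Rw : B.Cfg → κ → Module.End ℝ (g.Site → ℝ)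

/-- **THE READING Theorem 3.9's localisation clause needs beyond the letters**: `AgreeC □ U U′` = «U, U′ coincide on □̃⁵»,
`Agree c U U′` = «U, U′ coincide on X̃⁵» for c = (α, X) (p. 413: *"it depends on U restricted to X̃⁵"*; p. 408: *"we define □̃ⁿ as a
cube of the size (2 + 2n)ML^jη"*) — the carrier `B9.Backgrounds.Cfg` has no restriction structure, so the relations are data
(pattern of `B9Cor38Whole.WalkReading`).  Nothing asserted. [cite: Balaban1985BackgroundPropagators, Thm 3.9 p.413 + p.408] -/
structure WalkReading39 (B : B9.Backgrounds) (ι κ : Type) where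
  AgreeC : ι → B.Cfg → B.Cfg → Prop
  Agree : κ → B.Cfg → B.Cfg → Prop

variable [Fintype ι]

/-- **C₀ = Σ_{□∈𝒟} h_□C_□h_□** (3.87), spelled from the letters. [cite: Balaban1985BackgroundPropagators, (3.87) p.409] -/
def C0 (𝔬 : Ops39 g B ι κ) (U : B.Cfg) : Module.End ℝ (g.Site → ℝ) :=
  ∑ i, mulOp (𝔬.h i) * 𝔬.Cl U i * mulOp (𝔬.h i)

/-- **The operator R of (3.95)**: R = −(Σ_□(1 − □̃)L·h_□C_□h_□ + Σ_□ □̃(L − L_□)h_□C_□h_□ + Σ_□(□̃L_□h_□ − h_□□̃L_□)C_□h_□), spelled from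
the letters in exactly the shape of `B9Thm39Sum.eq395_oneSub`. [cite: Balaban1985BackgroundPropagators, (3.95) p.411] -/
def Rop (𝔬 : Ops39 g B ι κ) (U : B.Cfg) : Module.End ℝ (g.Site → ℝ) :=
  -(∑ i, (1 - mulOp (𝔬.chi i)) * 𝔬.L U * (mulOp (𝔬.h i) * 𝔬.Cl U i * mulOp (𝔬.h i)) +
      ∑ i, mulOp (𝔬.chi i) * (𝔬.L U - 𝔬.Lloc U i) * (mulOp (𝔬.h i) * 𝔬.Cl U i * mulOp (𝔬.h i)) +
      ∑ i, (mulOp (𝔬.chi i) * 𝔬.Lloc U i * mulOp (𝔬.h i) - mulOp (𝔬.h i) * (mulOp (𝔬.chi i) * 𝔬.Lloc U i)) *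
        𝔬.Cl U i * mulOp (𝔬.h i))

omit [Fintype g.Site] [DecidableEq g.Site] [Fintype ι] in
/-- **The factors of the term of (3.98) for the walk ω = ((0, □₀), (α₁, X₁), …, (αₙ, Xₙ))** at U: F₀ = R′₀(□₀) = h_{□₀}C_{□₀}(U)h_{□₀}
(p. 413: *"R′₀(□) = h_□C_□h_□"*), F_k = R′_{α_k}(X_k) (k ≧ 1); the term is `B9Thm37Sum.lprod` of these.
[cite: Balaban1985BackgroundPropagators, (3.98) p.413] -/
def walkOps39 (𝔬 : Ops39 g B ι κ) (U : B.Cfg) (q : ι) (ω : ℕ → κ) (k : ℕ) : Module.End ℝ (g.Site → ℝ) :=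
  if k = 0 then mulOp (𝔬.h q) * 𝔬.Cl U q * mulOp (𝔬.h q) else 𝔬.Rw U (ω k)

omit [Fintype g.Site] [DecidableEq g.Site] [Fintype ι] in
/-- The localisation sets along the walk: S_{□₀} for the head factor, X_k ∩ 𝔅 for the factors R′_{α_k}(X_k) — the sets over
which (3.93) takes its infimum here (*"but the infimum is taken over yᵢ ∈ Xᵢ ∩ 𝔅"*, p. 413).
[cite: Balaban1985BackgroundPropagators, (3.93) p.410 + Thm 3.9 p.413] -/
def walkSets39 (𝔬 : Ops39 g B ι κ) (q : ι) (ω : ℕ → κ) (k : ℕ) : Finset g.Site :=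
  if k = 0 then 𝔬.S q else 𝔬.Sw (ω k)

omit [Fintype g.Site] [DecidableEq g.Site] [Fintype ι] in
/-- The head factor is h_{□₀}C_{□₀}h_{□₀}. [cite: Balaban1985BackgroundPropagators, (3.98) p.413] -/
theorem walkOps39_zero (𝔬 : Ops39 g B ι κ) (U : B.Cfg) (q : ι) (ω : ℕ → κ) :
    walkOps39 𝔬 U q ω 0 = mulOp (𝔬.h q) * 𝔬.Cl U q * mulOp (𝔬.h q) := by
  simp [walkOps39]

omit [Fintype g.Site] [DecidableEq g.Site] [Fintype ι] in
/-- The k-th factor, k ≠ 0, is R′_{α_k}(X_k). [cite: Balaban1985BackgroundPropagators, (3.98) p.413] -/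
theorem walkOps39_of_ne (𝔬 : Ops39 g B ι κ) (U : B.Cfg) (q : ι) (ω : ℕ → κ) {k : ℕ} (hk : k ≠ 0) :
    walkOps39 𝔬 U q ω k = 𝔬.Rw U (ω k) := by
  simp [walkOps39, hk]

omit [Fintype g.Site] [DecidableEq g.Site] [Fintype ι] in
/-- The head localisation set is S_{□₀}. [cite: Balaban1985BackgroundPropagators, (3.93) p.410] -/
theorem walkSets39_zero (𝔬 : Ops39 g B ι κ) (q : ι) (ω : ℕ → κ) : walkSets39 𝔬 q ω 0 = 𝔬.S q := by
  simp [walkSets39]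

omit [Fintype g.Site] [DecidableEq g.Site] [Fintype ι] in
/-- The k-th localisation set, k ≠ 0, is X_k ∩ 𝔅. [cite: Balaban1985BackgroundPropagators, Thm 3.9 p.413] -/
theorem walkSets39_of_ne (𝔬 : Ops39 g B ι κ) (q : ι) (ω : ℕ → κ) {k : ℕ} (hk : k ≠ 0) :
    walkSets39 𝔬 q ω k = 𝔬.Sw (ω k) := by
  simp [walkSets39, hk]

omit [Fintype g.Site] [Fintype ι] in
/-- **«(Q′G′²Q′\*)⁻¹ = C₀(I − R)⁻¹ = Σ C₀Rⁿ … The series is convergent in the weighted supremum norm on 𝔅 appearing in the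
inequality (3.48)»** (3.96) READ ON THE INVERSE: the operator L(U) = Q′G′²Q′\* has a two-sided inverse T on the functions on 𝔅
(the space is finite-dimensional) whose kernel w.r.t. the pairing weight (L^{j′}η)^d obeys (3.48) with constants (B₁, δ₁):
|T(y, y′)| ≦ B₁(L^jη)^{−4}(L^{j′}η)^{−d}e^{−δ₁d(y,y′)}.  This is the content `B9Thm39Sum.inverse_kernel_348_of_395` concludes.
[cite: Balaban1985BackgroundPropagators, (3.96) p.411 + Thm 3.2 (3.48) p.398] -/
def Conv348 (𝔬 : Ops39 g B ι κ) (d : ℕ) (B₁ δ₁ : ℝ) (U : B.Cfg) : Prop :=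
  ∃ T : Module.End ℝ (g.Site → ℝ), T * 𝔬.L U = 1 ∧ 𝔬.L U * T = 1 ∧
    ∀ y y' : g.Site, |ker (vol g d) T y y'| ≤
      B₁ * g.len y ^ (-(4 : ℝ)) * g.len y' ^ (-(d : ℝ)) * Real.exp (-(δ₁ * g.dist y y'))

omit [Fintype g.Site] [Fintype ι] in
/-- ★ **THE KERNEL EXPANSION DATUM OF THEOREM 3.9 WITH EVERY FIELD PINNED.**  `Walk` = triples (n, □₀, ω) reading the walk
((0, □₀), (α₁, X₁), …, (αₙ, Xₙ)) with (α_k, X_k) = ω k (the head index is a cube □₀ ∈ 𝒟: p. 413 *"R′₀(□) = h_□C_□h_□, R′₀(X) = 0 for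
localization domains bigger than a cube"*, so the walks dropped contribute zero terms); `wlen` = |ω| = n; `wdist` = d(ω, y, y′)
of (3.93) with the infimum over X_k ∩ 𝔅 (`B9Cor38Whole.minLen`, certified as an admissible lower bound by `LB_minLen`);
`kterm U (n, □₀, ω) y y′` = the kernel (R′₀(□₀)R′_{α₁}(X₁)⋯R′_{αₙ}(Xₙ))(y, y′) w.r.t. (L^{j′}η)^d; `LocDep U (n, □₀, ω)` = «the
term operator at U equals the one at every U′ coinciding with U on □̃⁵₀, X̃⁵₁, …, X̃⁵ₙ»; `Converges U := Conv348 𝔬 d B₁ δ₁ U`.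
[cite: Balaban1985BackgroundPropagators, Thm 3.9 (3.98)–(3.99) p.413 + (3.96) p.411 + (3.93) p.410] -/
def EK39OfOps (𝔬 : Ops39 g B ι κ) (rd : WalkReading39 B ι κ) (d : ℕ) (B₁ δ₁ : ℝ) : B9.RWKernelExpansion g B where
  Walk := ℕ × ι × (ℕ → κ)
  wlen w := w.1
  wdist w y y' := minLen g.dist (walkSets39 𝔬 w.2.1 w.2.2) w.1 y y'
  kterm U w y y' := ker (vol g d) (lprod (walkOps39 𝔬 U w.2.1 w.2.2) w.1) y y'
  LocDep U w := ∀ U' : B.Cfg, rd.AgreeC w.2.1 U U' → (∀ k, 1 ≤ k → k ≤ w.1 → rd.Agree (w.2.2 k) U U') →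
    lprod (walkOps39 𝔬 U w.2.1 w.2.2) w.1 = lprod (walkOps39 𝔬 U' w.2.1 w.2.2) w.1
  Converges U := Conv348 𝔬 d B₁ δ₁ U

omit [Fintype g.Site] [Fintype ι] in
/-- The convergence predicate of `EK39OfOps` IS `Conv348` (by `Iff.rfl`): the typed reading of (3.96).
[cite: Balaban1985BackgroundPropagators, (3.96) p.411] -/
theorem converges_EK39OfOps (𝔬 : Ops39 g B ι κ) (rd : WalkReading39 B ι κ) (d : ℕ) (B₁ δ₁ : ℝ) (U : B.Cfg) :
    (EK39OfOps 𝔬 rd d B₁ δ₁).Converges U ↔ Conv348 𝔬 d B₁ δ₁ U :=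
  Iff.rfl

/-! ## §2 The hypothesis schemas (printed shape; nothing asserted) -/

omit [Fintype g.Site] [DecidableEq g.Site] in
/-- **THE STATIC DATA AT ONE MEMBER** (independent of U): the multiscale distance d of [4] (2.46) satisfies (2.54), d(y, y) = 0,
d ≧ 0; L^jη > 0; the partition of unity has |h_□| ≦ 1 on 𝔅 with h_□(y) ≠ 0 only for y ∈ S_□, Σ_□h_□² = 1 (p. 408: *"We have
Σ_{□∈𝒟}h²_□ = 1"*) and □̃h_□ = h_□ (□̃ ⊇ supp h_□); every site of 𝔅 lies in at most N of the S_□ (the cubes □̃ overlap finitely often;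
cell GAPS G-B9-22).  Hypotheses of the lineage theorems, bundled. [cite: Balaban1985BackgroundPropagators, (3.87) p.409 + p.408; Balaban1984PropagatorsII, (2.46) p.231 + (2.54) p.233] -/
structure StaticOK39 (𝔬 : Ops39 g B ι κ) (N : ℝ) : Prop where
  tri : ∀ a b c : g.Site, g.dist a c ≤ g.dist a b + g.dist b c
  refl : ∀ y : g.Site, g.dist y y = 0
  dnn : ∀ y y' : g.Site, 0 ≤ g.dist y y'
  lenpos : ∀ y : g.Site, 0 < g.len y
  hh : ∀ i y, |𝔬.h i y| ≤ 1
  hS : ∀ i y, 𝔬.h i y ≠ 0 → y ∈ 𝔬.S i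
  hpu : ∀ y, ∑ i, 𝔬.h i y ^ 2 = 1
  hchi : ∀ i y, 𝔬.chi i y * 𝔬.h i y = 𝔬.h i y
  cnt : ∀ a : g.Site, (∑ i, if a ∈ 𝔬.S i then (1 : ℝ) else 0) ≤ N

omit [Fintype g.Site] [Fintype ι] in
/-- **«THE OPERATORS … C_□(U) … SATISFY ALL THE INEQUALITIES OF THEOREMS 3.1–3.3»** (p. 409) at U — Theorem 3.2 (3.48) for every
local inverse C_□(U), in the printed kernel notation with one pair (B₀, δ₀): |C_□(U)(y, y′)| ≦ B₀(L^jη)^{−4}(L^{j′}η)^{−d}e^{−δ₀d(y,y′)}.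
A HYPOTHESIS SCHEMA (by the induction of Sect. C for the local sequences {Ω_n(□)}; not asserted).
[cite: Balaban1985BackgroundPropagators, p.409 + Thm 3.2 (3.48) p.398] -/
structure Local348 (𝔬 : Ops39 g B ι κ) (d : ℕ) (B₀ δ₀ : ℝ) (U : B.Cfg) : Prop where
  cl : ∀ (i : ι) (y y' : g.Site), |ker (vol g d) (𝔬.Cl U i) y y'| ≤
    B₀ * g.len y ^ (-(4 : ℝ)) * g.len y' ^ (-(d : ℝ)) * Real.exp (-(δ₀ * g.dist y y'))

omit [Fintype g.Site] [DecidableEq g.Site] [Fintype ι] in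
/-- **The local inverse identities at U**: C_□(U) = (Q′G′²_□Q′\*)⁻¹ posed on the functions on 𝔅, i.e. L_□·C_□ = I (p. 409).  Nothing
asserted. [cite: Balaban1985BackgroundPropagators, (3.87) p.409 + (3.95) p.411] -/
structure Identities395 (𝔬 : Ops39 g B ι κ) (U : B.Cfg) : Prop where
  inv : ∀ i : ι, 𝔬.Lloc U i * 𝔬.Cl U i = 1

omit [Fintype g.Site] in
/-- **«BY THE SAME ESTIMATES AS IN [4], ESPECIALLY (2.83)–(2.85), WE CAN SEE THAT THE OPERATOR R IS SMALL»** (p. 411) — the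
(2.85)-shape kernel bound of R of (3.95) with its O(M⁻¹) named θ₀M⁻¹ and the rate r: |R(y, y′)| ≦ θ₀M⁻¹(L^{j′}η)^{−d}e^{−r·d(y,y′)}
([4] (2.85): *"|R(y, y′)| ≦ O(M⁻¹)e^{−δ₁d(y,y′)}(L^{j′}η)^{−d}"*).  BY REFERENCE — exactly the hypothesis `hRk` of the lineage's
`B9Thm39Sum.inverse_kernel_348_of_395` (whose §2b kernel-checks the (2.83)-part for the first sum; the second and third sums rest
on (3.97) from [2] and the commutator estimate, cell GAPS G-B9-05 ∕ G-B9-07).  Nothing asserted.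
[cite: Balaban1985BackgroundPropagators, (3.95)–(3.97) pp.411–412; Balaban1984PropagatorsII, (2.83)–(2.85) p.238] -/
structure Small285 (𝔬 : Ops39 g B ι κ) (d : ℕ) (θ₀ r : ℝ) (U : B.Cfg) : Prop where
  rk : ∀ y y' : g.Site, |ker (vol g d) (Rop 𝔬 U) y y'| ≤
    θ₀ * g.M⁻¹ * g.len y' ^ (-(d : ℝ)) * Real.exp (-(r * g.dist y y'))

omit [Fintype g.Site] [Fintype ι] in
/-- **THE FACTORS R′_α(X), α ≠ 0** (p. 413: *"An operator R(X) … is localized in X, i.e. its kernel has a support in X × X, …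
and satisfies a bound of the type (3.89), possibly with an additional power of L^jη"*): in the printed kernel notation,
|R′_α(X)(y, y′)| ≦ 1_X(y)·θ₀M⁻¹·(L^{j′}η)^{−d}e^{−δ₀d(y,y′)} — the O(M⁻¹) of (3.89) named θ₀M⁻¹, the localisation kept on the
observation side (what the chain estimate reads).  The *"additional power of L^jη"* of factors acting between scales is NOT
modelled (all letters act on the functions on 𝔅; census D-b09.14 (v)).  Print itself declines to make the factor bound
precise (*"It is difficult to make the last statement more precise"*): a HYPOTHESIS SCHEMA of (3.89)-shape, exactly the input
`hR` of the lineage's `B9Thm39Sum.term399_majorant`. [cite: Balaban1985BackgroundPropagators, (3.89) p.409 + Thm 3.9 p.413] -/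
structure Factors389 (𝔬 : Ops39 g B ι κ) (d : ℕ) (θ₀ δ₀ : ℝ) (U : B.Cfg) : Prop where
  rw : ∀ (c : κ) (y y' : g.Site), |ker (vol g d) (𝔬.Rw U c) y y'| ≤
    (if y ∈ 𝔬.Sw c then θ₀ * g.M⁻¹ else 0) * g.len y' ^ (-(d : ℝ)) * Real.exp (-(δ₀ * g.dist y y'))

omit [Fintype g.Site] [DecidableEq g.Site] [Fintype ι] in
/-- **THE PRINTED LOCALITY INPUTS** (p. 410: *"A propagator G′_□ depends on U restricted to Ω₀(□) ⊂ □̃⁵"* — hence so does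
C_□ = (Q′G′²_□Q′\*)⁻¹ and the head factor h_□C_□h_□; p. 413: R′_α(X) *"depends on U restricted to X̃⁵"*), as a hypothesis schema on
the letters: the factors coincide at configurations coinciding on □̃⁵ resp. X̃⁵.  Nothing asserted.
[cite: Balaban1985BackgroundPropagators, Cor. 3.8 p.410 + Thm 3.9 p.413] -/
structure Locality39 (𝔬 : Ops39 g B ι κ) (rd : WalkReading39 B ι κ) : Prop where
  cl : ∀ (q : ι) (U U' : B.Cfg), rd.AgreeC q U U' →
    mulOp (𝔬.h q) * 𝔬.Cl U q * mulOp (𝔬.h q) = mulOp (𝔬.h q) * 𝔬.Cl U' q * mulOp (𝔬.h q)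
  rw : ∀ (c : κ) (U U' : B.Cfg), rd.Agree c U U' → 𝔬.Rw U c = 𝔬.Rw U' c

/-! ## §3 Theorem 3.9 at one member and one configuration -/

omit [Fintype g.Site] [DecidableEq g.Site] in
/-- **(3.95): Q′G′²Q′\*C₀ = I − R**, from the local inverse identities L_□C_□ = I, □̃h_□ = h_□ and Σ_□h_□² = I — the lineage's ring
identity `B9Thm39Sum.eq395_oneSub` at the letters (p. 411: *"We write it in the same way as in (2.82) [4]"*).
[cite: Balaban1985BackgroundPropagators, (3.95) p.411; Balaban1984PropagatorsII, (2.82) p.237] -/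
theorem L_mul_C0_eq (𝔬 : Ops39 g B ι κ) (U : B.Cfg) (hpu : ∀ y, ∑ i, 𝔬.h i y ^ 2 = 1)
    (hchi : ∀ i y, 𝔬.chi i y * 𝔬.h i y = 𝔬.h i y) (hinv : ∀ i : ι, 𝔬.Lloc U i * 𝔬.Cl U i = 1) :
    𝔬.L U * C0 𝔬 U = 1 - Rop 𝔬 U := by
  have hχ : ∀ i, mulOp (𝔬.chi i) * mulOp (𝔬.h i) = mulOp (𝔬.h i) := by
    intro i
    apply LinearMap.ext
    intro μ
    funext x
    simp only [Module.End.mul_apply, mulOp_apply]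
    rw [← mul_assoc, hchi i x]
  exact eq395_oneSub (𝔬.L U) (fun i => mulOp (𝔬.h i)) (fun i => mulOp (𝔬.chi i)) (fun i => 𝔬.Cl U i)
    (fun i => 𝔬.Lloc U i) (fun i => hloc_of_inverse (hinv i) (hχ i)) (sum_mulOp_sq 𝔬.h hpu)

/-- **THEOREM 3.9's FIRST CLAUSE AT ONE MEMBER AND ONE U — (3.96) ⇒ (3.48) for (Q′G′²Q′\*)⁻¹, constants and threshold explicit.**
From: the static data (`StaticOK39`), (3.48) for the C_□(U) at (B₀, δ₀) (`Local348`; the rate weakened to r ≦ δ₀), L_□C_□ = I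
(`Identities395`), the (2.85)-shape bound of R at (θ₀M⁻¹, r) (`Small285`), [4] Lemma 2.1 (2.61) at (r, α′) with α′ ≦ 1, and «M
sufficiently large» LOCATED as M ≧ 2θ₀c₁(r, α′): L(U) has a two-sided inverse obeying (3.48) with **B₁ = 2NB₀c₁(r, α′),
δ₁ = (1 − α′)r** — `Conv348 𝔬 d B₁ δ₁ U`.  Route: `c0_majorant` (C₀ obeys (3.48) with NB₀, localized), `L_mul_C0_eq` ((3.95)),
`inverse_kernel_348_of_395` ((3.96): the Neumann series C₀(I − R)⁻¹, [4] (2.66)).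
[cite: Balaban1985BackgroundPropagators, (3.95)–(3.96) p.411 + Thm 3.2 (3.48) p.398; Balaban1984PropagatorsII, (2.85)–(2.87) p.238 + Lemma 2.1 (2.61) p.234] -/
theorem conv348_of_local348 (𝔬 : Ops39 g B ι κ) (R : ℝ) (H : Prop) (d : ℕ) (r α' θ₀ B₀ δ₀ N : ℝ) (U : B.Cfg)
    (hr : 0 ≤ r) (hrδ : r ≤ δ₀) (hα' : α' ≤ 1) (hθ₀ : 0 ≤ θ₀) (hB₀ : 0 ≤ B₀) (hN : 0 ≤ N) (hM : 0 < g.M)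
    (hMbig : 2 * θ₀ * B6.c1 d r α' ≤ g.M) (hs : StaticOK39 𝔬 N) (h261 : Ineq261 d (toB6 g R H) r α')
    (hl : Local348 𝔬 d B₀ δ₀ U) (hi : Identities395 𝔬 U) (hR : Small285 𝔬 d θ₀ r U) :
    Conv348 𝔬 d (2 * (N * B₀) * B6.c1 d r α') ((1 - α') * r) U := by
  have hlen : ∀ y : g.Site, 0 < g.len y := hs.lenpos
  have hvol := vol_pos d hlen
  have htri : Triangle254 (toB6 g R H) := fun a b c => hs.tri a b c
  -- (3.95)
  have h395 : 𝔬.L U * C0 𝔬 U = 1 - Rop 𝔬 U := L_mul_C0_eq 𝔬 U hs.hpu hs.hchi hi.inv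
  -- the (3.48)-majorants of the C_□(U) in entry form, at the weaker rate r
  have hC : ∀ i, HasMajorant (g := toB6 g R H) (fun x : g.Site => x) (𝔬.Cl U i)
      (fun (a b : g.Site) => B₀ * (g.len a ^ (-(4 : ℝ))) * Real.exp (-(r * g.dist a b))) := by
    intro i
    refine (hasMajorant_id_iff _ _).mpr fun a b => ?_
    have h1 : |entry (𝔬.Cl U i) a b| ≤ B₀ * g.len a ^ (-(4 : ℝ)) * Real.exp (-(δ₀ * g.dist a b)) := by
      refine (ker_le_iff (vol g d) (hvol b) (𝔬.Cl U i) a _).mp ?_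
      refine (hl.cl i a b).trans (le_of_eq ?_)
      rw [vol_inv d hlen b]
      ring
    refine h1.trans ?_
    have hexp : Real.exp (-(δ₀ * g.dist a b)) ≤ Real.exp (-(r * g.dist a b)) :=
      Real.exp_le_exp.mpr (by nlinarith [hs.dnn a b])
    exact mul_le_mul_of_nonneg_left hexp (mul_nonneg hB₀ (Real.rpow_nonneg (hlen a).le _))
  -- C₀ obeys (3.48) with NB₀ (localized sum)
  have hC0 := c0_majorant (R := R) (H := H) B₀ r N (fun y => g.len y ^ (-(4 : ℝ))) 𝔬.S 𝔬.h (fun i => 𝔬.Cl U i) hB₀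
    (fun y => Real.rpow_nonneg (hlen y).le _) hs.hh hs.hS hC hs.cnt
  have hC0k : ∀ y y' : g.Site, |ker (vol g d) (C0 𝔬 U) y y'| ≤
      N * B₀ * g.len y ^ (-(4 : ℝ)) * g.len y' ^ (-(d : ℝ)) * Real.exp (-(r * g.dist y y')) := by
    intro y y'
    have hent := (hasMajorant_id_iff _ _).mp hC0 y y'
    have hk := (ker_le_iff (vol g d) (hvol y') (C0 𝔬 U) y _).mpr hent
    refine hk.trans (le_of_eq ?_)
    rw [vol_inv d hlen y']
    ring
  obtain ⟨T, hTL, hLT, -, hb⟩ := inverse_kernel_348_of_395 (R := R) (H := H) d r α' θ₀ (N * B₀) hr hα' hθ₀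
    (mul_nonneg hN hB₀) hM hMbig htri hs.refl hs.dnn hlen h261 h395 hC0k hR.rk
  exact ⟨T, hTL, hLT, hb⟩

omit [Fintype g.Site] [DecidableEq g.Site] [Fintype ι] in
/-- Left-nested products only read their first n + 1 factors: equal factors give equal products. [folklore] -/
private theorem lprod_congr {X : Type} {F F' : ℕ → Module.End ℝ (X → ℝ)} :
    ∀ (n : ℕ), (∀ k, k ≤ n → F k = F' k) → lprod F n = lprod F' n := by
  intro n
  induction n generalizing F F' with
  | zero => intro h; exact h 0 le_rfl
  | succ n ih =>
      intro h
      show F 0 * lprod (fun i => F (i + 1)) n = F' 0 * lprod (fun i => F' (i + 1)) n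
      rw [h 0 (Nat.zero_le _), ih (fun k hk => h (k + 1) (by omega))]

omit [Fintype g.Site] [Fintype ι] in
/-- **The U-localisation clause of Theorem 3.9** (*"A term in this expansion corresponding to a walk ω depends on U restructed [sic]
to X̃⁵₀ ∪ X̃⁵₁ ∪ … ∪ X̃⁵ₙ"*) at `EK39OfOps`, from the printed locality inputs (`Locality39`).
[cite: Balaban1985BackgroundPropagators, Thm 3.9 p.413] -/
theorem locDep_EK39OfOps (𝔬 : Ops39 g B ι κ) (rd : WalkReading39 B ι κ) (d : ℕ) (B₁ δ₁ : ℝ) (hloc : Locality39 𝔬 rd)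
    (U : B.Cfg) (w : ℕ × ι × (ℕ → κ)) : (EK39OfOps 𝔬 rd d B₁ δ₁).LocDep U w := by
  intro U' hC hX
  refine lprod_congr w.1 fun k hk => ?_
  by_cases hk0 : k = 0
  · subst hk0
    rw [walkOps39_zero, walkOps39_zero]
    exact hloc.cl w.2.1 U U' hC
  · rw [walkOps39_of_ne 𝔬 U w.2.1 w.2.2 hk0, walkOps39_of_ne 𝔬 U' w.2.1 w.2.2 hk0]
    exact hloc.rw (w.2.2 k) U U' (hX k (Nat.one_le_iff_ne_zero.mpr hk0) hk)

/-- **THE BOUND (3.99) at one member and one configuration U** (p. 413: *"|(R′₀(X₀)R′_{α₁}(X₁)·⋯·R′_{αₙ}(Xₙ))(y, y′)| ≦ O(1)(L^jη)^{−4}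
(L^{j′}η)^{−d}O(M^{−1/2})^{|ω|}M^{−½|ω|}e^{−½δ₀d(ω,y,y′)}, y ∈ Λ_j, y′ ∈ Λ_{j′}"*) at the datum `EK39OfOps`, with O(1) = B₀, O(M^{−1/2}) =
(θ₀c₁(α) + 1)M^{−1/2} and the rate ½·2(1 − α)δ₀ (α = ½ in print): from (3.48) for C_{□₀}(U) (`Local348`; the head factor h_{□₀}C_{□₀}h_{□₀}
localized by `B9Thm37Sum.hasMajorant_sandwich_local`), the (3.89)-type bounds of the factors R′_{α_k}(X_k) (`Factors389`), (2.61)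
at α and the static data — by the lineage's chain estimate `B9Thm39Sum.term399_majorant` (Corollary 3.8's mechanism
(3.91)–(3.92)), `LB_minLen` ((3.93)) and `B9.split_small_factor` ((θ₀M⁻¹c₁)ⁿ ≦ ((θ₀c₁ + 1)M^{−1/2})ⁿM^{−n/2}).
[cite: Balaban1985BackgroundPropagators, Thm 3.9 (3.99) p.413 + Cor. 3.8 (3.91)–(3.94) p.410 + (3.89) p.409; Balaban1984PropagatorsII, Lemma 2.1 (2.61) p.234] -/
theorem kterm_EK39OfOps_le (𝔬 : Ops39 g B ι κ) (rd : WalkReading39 B ι κ) (R : ℝ) (H : Prop) (d : ℕ)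
    (B₁ δ₁ δ₀ α θ₀ B₀ N : ℝ) (U : B.Cfg) (hδ₀ : 0 ≤ δ₀) (hα : 0 ≤ α) (hα1 : α ≤ 1) (hθ₀ : 0 ≤ θ₀) (hB₀ : 0 ≤ B₀)
    (hM : 0 < g.M) (hs : StaticOK39 𝔬 N) (h261 : Ineq261 d (toB6 g R H) δ₀ α) (hl : Local348 𝔬 d B₀ δ₀ U)
    (hf : Factors389 𝔬 d θ₀ δ₀ U) (w : ℕ × ι × (ℕ → κ)) (y y' : g.Site) :
    |(EK39OfOps 𝔬 rd d B₁ δ₁).kterm U w y y'| ≤ g.len y ^ (-(4 : ℝ)) * g.len y' ^ (-(d : ℝ)) *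
      B9.walkFactor B₀ (θ₀ * B6.c1 d δ₀ α + 1) g.M (2 * ((1 - α) * δ₀)) ((EK39OfOps 𝔬 rd d B₁ δ₁).wlen w)
        ((EK39OfOps 𝔬 rd d B₁ δ₁).wdist w y y') := by
  obtain ⟨n, q, ω⟩ := w
  have hlen : ∀ z : g.Site, 0 < g.len z := hs.lenpos
  have hvol := vol_pos d hlen
  have hc1 : 0 ≤ B6.c1 d δ₀ α := c1_nonneg d δ₀ α
  have hMinv : 0 ≤ g.M⁻¹ := inv_nonneg.mpr hM.le
  have hθ : 0 ≤ θ₀ * g.M⁻¹ := mul_nonneg hθ₀ hMinv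
  have hαδ : 0 ≤ α * δ₀ := mul_nonneg hα hδ₀
  have h1αδ : 0 ≤ (1 - α) * δ₀ := mul_nonneg (by linarith) hδ₀
  set S : ℕ → Finset g.Site := walkSets39 𝔬 q ω with hSdef
  set W₀ : g.Site → ℝ := fun a => B₀ * g.len a ^ (-(4 : ℝ)) with hW₀def
  have hW₀ : ∀ a, 0 ≤ W₀ a := fun a => mul_nonneg hB₀ (Real.rpow_nonneg (hlen a).le _)
  -- the head factor h_{□₀}C_{□₀}h_{□₀}: (3.48) for C_{□₀}, localized to S_{□₀}
  have hCq : HasMajorant (g := toB6 g R H) (fun x : g.Site => x) (𝔬.Cl U q)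
      (fun (a b : g.Site) => W₀ a * Real.exp (-(δ₀ * g.dist a b))) := by
    refine (hasMajorant_id_iff _ _).mpr fun a b => ?_
    refine (ker_le_iff (vol g d) (hvol b) (𝔬.Cl U q) a _).mp ?_
    refine (hl.cl q a b).trans (le_of_eq ?_)
    rw [vol_inv d hlen b, hW₀def]
    ring
  have hT0 : HasMajorant (g := toB6 g R H) (fun x : g.Site => x) (walkOps39 𝔬 U q ω 0)
      (fun (a b : g.Site) => if a ∈ S 0 then W₀ a * Real.exp (-(δ₀ * g.dist a b)) else 0) := by
    rw [walkOps39_zero]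
    have h := hasMajorant_sandwich_local (R := R) (H := H) (fun x : g.Site => x) hCq (𝔬.h q) (hs.hh q) (𝔬.S q) (hs.hS q)
    refine hasMajorant_mono (g := toB6 g R H) _ h fun a b => le_of_eq ?_
    rw [hSdef, walkSets39_zero]
  -- the factors R′_{α_k}(X_k), k ≥ 1: (3.89)-type bounds, localized to X_k ∩ 𝔅
  have hR : ∀ i, 1 ≤ i → i ≤ n → HasMajorant (g := toB6 g R H) (fun x : g.Site => x) (walkOps39 𝔬 U q ω i)
      (fun (a b : g.Site) => if a ∈ S i then θ₀ * g.M⁻¹ * Real.exp (-(δ₀ * g.dist a b)) else 0) := by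
    intro i hi _
    have hi0 : i ≠ 0 := by omega
    rw [walkOps39_of_ne 𝔬 U q ω hi0]
    refine (hasMajorant_id_iff _ _).mpr fun a b => ?_
    have hk := (ker_le_iff (vol g d) (hvol b) (𝔬.Rw U (ω i)) a
      ((if a ∈ 𝔬.Sw (ω i) then θ₀ * g.M⁻¹ else 0) * Real.exp (-(δ₀ * g.dist a b)))).mp (by
        refine (hf.rw (ω i) a b).trans (le_of_eq ?_)
        rw [vol_inv d hlen b]
        ring)
    refine hk.trans (le_of_eq ?_)
    rw [hSdef, walkSets39_of_ne 𝔬 q ω hi0]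
    split_ifs <;> ring
  -- the chain estimate (3.91)–(3.92) ⇒ (3.99)-shape majorant of the term
  have hmaj := term399_majorant (R := R) (H := H) (fun x : g.Site => x) d δ₀ α (θ₀ * g.M⁻¹) W₀ S (walkOps39 𝔬 U q ω)
    (minLen g.dist S n) n hW₀ hθ hs.dnn hαδ h1αδ h261 hT0 hR (fun a b => LB_minLen g.dist n S a b)
  have hent := (hasMajorant_id_iff _ _).mp hmaj y y'
  have hk := (ker_le_iff (vol g d) (hvol y') (lprod (walkOps39 𝔬 U q ω) n) y _).mpr hent
  -- arithmetic: 1_{S₀}(y)W₀(y) ≤ B₀(L^jη)^{−4}; (θ₀M⁻¹c₁)ⁿ ≤ ((θ₀c₁ + 1)M^{−1/2})ⁿM^{−n/2}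
  have hhead : (if y ∈ S 0 then W₀ y else 0) ≤ B₀ * g.len y ^ (-(4 : ℝ)) := by
    split_ifs
    · exact le_rfl
    · exact hW₀ y
  have hθc : θ₀ * g.M⁻¹ * B6.c1 d δ₀ α ≤ (θ₀ * B6.c1 d δ₀ α + 1) * g.M⁻¹ := by
    have h0 : 0 ≤ 1 * g.M⁻¹ := by rw [one_mul]; exact hMinv
    nlinarith
  have hpow : (θ₀ * g.M⁻¹ * B6.c1 d δ₀ α) ^ n ≤ ((θ₀ * B6.c1 d δ₀ α + 1) * g.M⁻¹) ^ n :=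
    pow_le_pow_left₀ (mul_nonneg hθ hc1) hθc n
  have hexp : Real.exp (-((1 - α) * δ₀ * minLen g.dist S n y y')) =
      Real.exp (-(2 * ((1 - α) * δ₀) / 2 * minLen g.dist S n y y')) := by
    congr 1
    ring
  have hE : 0 ≤ Real.exp (-((1 - α) * δ₀ * minLen g.dist S n y y')) := Real.exp_nonneg _
  have hfac : (if y ∈ S 0 then W₀ y else 0) * (θ₀ * g.M⁻¹ * B6.c1 d δ₀ α) ^ n *
        Real.exp (-((1 - α) * δ₀ * minLen g.dist S n y y')) * (vol g d y')⁻¹ ≤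
      g.len y ^ (-(4 : ℝ)) * g.len y' ^ (-(d : ℝ)) *
        B9.walkFactor B₀ (θ₀ * B6.c1 d δ₀ α + 1) g.M (2 * ((1 - α) * δ₀)) n (minLen g.dist S n y y') := by
    rw [vol_inv d hlen y']
    have hvd : 0 ≤ g.len y' ^ (-(d : ℝ)) := Real.rpow_nonneg (hlen y').le _
    calc (if y ∈ S 0 then W₀ y else 0) * (θ₀ * g.M⁻¹ * B6.c1 d δ₀ α) ^ n *
          Real.exp (-((1 - α) * δ₀ * minLen g.dist S n y y')) * g.len y' ^ (-(d : ℝ))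
        ≤ B₀ * g.len y ^ (-(4 : ℝ)) * ((θ₀ * B6.c1 d δ₀ α + 1) * g.M⁻¹) ^ n *
          Real.exp (-((1 - α) * δ₀ * minLen g.dist S n y y')) * g.len y' ^ (-(d : ℝ)) := by
          refine mul_le_mul_of_nonneg_right (mul_le_mul_of_nonneg_right ?_ hE) hvd
          exact mul_le_mul hhead hpow (pow_nonneg (mul_nonneg hθ hc1) n)
            (mul_nonneg hB₀ (Real.rpow_nonneg (hlen y).le _))
      _ = g.len y ^ (-(4 : ℝ)) * g.len y' ^ (-(d : ℝ)) *
          B9.walkFactor B₀ (θ₀ * B6.c1 d δ₀ α + 1) g.M (2 * ((1 - α) * δ₀)) n (minLen g.dist S n y y') := by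
          rw [B9.split_small_factor (θ₀ * B6.c1 d δ₀ α + 1) g.M hM n, hexp]
          simp only [B9.walkFactor]
          ring
  show |ker (vol g d) (lprod (walkOps39 𝔬 U q ω) n) y y'| ≤ g.len y ^ (-(4 : ℝ)) * g.len y' ^ (-(d : ℝ)) *
    B9.walkFactor B₀ (θ₀ * B6.c1 d δ₀ α + 1) g.M (2 * ((1 - α) * δ₀)) n (minLen g.dist (walkSets39 𝔬 q ω) n y y')
  rw [← hSdef]
  exact hk.trans hfac

end OneMember

/-! ## §4 The whole printed leaf at the pinned datum -/

section Family

variable {I : Type} {c35 : ℝ} {geo : I → B9.Geometry} {bg : I → B9.Backgrounds}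
variable [∀ i, Fintype (geo i).Site] [∀ i, DecidableEq (geo i).Site]
variable {ι κ : I → Type} [∀ i, Fintype (ι i)]

/-- ★ **THEOREM 3.9 AS THE WHOLE PRINTED LEAF `B9.Thm39Printed`** (p. 413: *"For M sufficiently large, and a configuration U
satisfying (3.35), the operator Q′G′²Q′\* has an inverse which can be represented as (Q′G′²Q′\*)⁻¹ = Σ_ω R′₀(X₀)R′_{α₁}(X₁)·⋯·R′_{αₙ}(Xₙ)
(3.98) … A term in this expansion corresponding to a walk ω depends on U restructed [sic] to X̃⁵₀ ∪ … ∪ X̃⁵ₙ, and has the following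
bound: … (3.99)"*), INHABITED at the pinned datum `EK39OfOps (𝔬 i) (rd i) d B₁ δ₁` with the explicit constants B₁ = 2NB₀c₁(r, α′),
δ₁ = (1 − α′)r of the convergence clause — from, per member and per U under the printed provisos (M ≧ M₁, 0 < α₀, O(1)Mα₀ ≦ a₁,
U satisfying (3.35) = `Reg335 c35 α₀ U`): (3.48) for the C_□(U) (`Local348`), the local inverse identities (`Identities395`),
the smallness of R (`Small285`, by reference) and the factor bounds (`Factors389`); per member: the static data (`StaticOK39`),
the locality inputs (`Locality39`), and [4] Lemma 2.1 (2.61) at (δ₀, α) and at (r, α′) for M ≧ M_L.  The printed quantifiers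
are met with M₂ := max(M₁, M_L, 2θ₀c₁(r, α′)) («for M sufficiently large», located), a₀ := a₁∕O(1) (O(1) = `c35`, the geometric
factor of (3.35)), the rate 2(1 − α)δ₀, O(1) := B₀, O(M^{−1/2}) := (θ₀c₁(δ₀, α) + 1)M^{−1/2}.  Nothing of print asserted (all
inputs are hypotheses of printed shape); NOT a node discharge.
[cite: Balaban1985BackgroundPropagators, Thm 3.9 (3.98)–(3.99) p.413 + (3.95)–(3.96) p.411 + (3.35) p.396; Balaban1984PropagatorsII, Lemma 2.1 (2.61) p.234 + (2.83)–(2.87) p.238] -/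
theorem thm39Printed_of_local348 (𝔬 : ∀ i, Ops39 (geo i) (bg i) (ι i) (κ i)) (rd : ∀ i, WalkReading39 (bg i) (ι i) (κ i))
    (R : I → ℝ) (H : I → Prop) (d : ℕ) (α α' r δ₀ θ₀ B₀ N a₁ M₁ ML : ℝ)
    (hc : 0 < c35) (hα : 0 ≤ α) (hα1 : α < 1) (hα' : α' ≤ 1) (hr : 0 ≤ r) (hrδ : r ≤ δ₀) (hδ₀ : 0 < δ₀)
    (hθ₀ : 0 ≤ θ₀) (hB₀ : 0 < B₀) (hN : 0 ≤ N) (ha₁ : 0 < a₁) (hM₁ : 0 < M₁)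
    (hst : ∀ i, StaticOK39 (𝔬 i) N) (hloc : ∀ i, Locality39 (𝔬 i) (rd i))
    (h261 : ∀ i, ML ≤ (geo i).M →
      Ineq261 d (toB6 (geo i) (R i) (H i)) δ₀ α ∧ Ineq261 d (toB6 (geo i) (R i) (H i)) r α')
    (h39 : ∀ i, M₁ ≤ (geo i).M → ∀ α₀ : ℝ, 0 < α₀ → c35 * (geo i).M * α₀ ≤ a₁ →
      ∀ U : (bg i).Cfg, (bg i).Reg335 c35 α₀ U →
        Local348 (𝔬 i) d B₀ δ₀ U ∧ Identities395 (𝔬 i) U ∧ Small285 (𝔬 i) d θ₀ r U ∧ Factors389 (𝔬 i) d θ₀ δ₀ U) :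
    B9.Thm39Printed d c35 geo bg
      (fun i => EK39OfOps (𝔬 i) (rd i) d (2 * (N * B₀) * B6.c1 d r α') ((1 - α') * r)) := by
  have hcpos : 0 < θ₀ * B6.c1 d δ₀ α + 1 := by
    have h0 : 0 ≤ θ₀ * B6.c1 d δ₀ α := mul_nonneg hθ₀ (c1_nonneg d δ₀ α)
    linarith
  refine ⟨max M₁ (max ML (2 * θ₀ * B6.c1 d r α')), a₁ / c35, 2 * ((1 - α) * δ₀), B₀, θ₀ * B6.c1 d δ₀ α + 1,
    lt_max_of_lt_left hM₁, div_pos ha₁ hc, by nlinarith, hB₀, hcpos, ?_⟩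
  intro i hM α₀ hα₀ hMa U hU
  have hM₁i : M₁ ≤ (geo i).M := le_trans (le_max_left _ _) hM
  have hMLi : ML ≤ (geo i).M := le_trans (le_trans (le_max_left _ _) (le_max_right _ _)) hM
  have hbig : 2 * θ₀ * B6.c1 d r α' ≤ (geo i).M := le_trans (le_trans (le_max_right _ _) (le_max_right _ _)) hM
  have hMpos : 0 < (geo i).M := lt_of_lt_of_le hM₁ hM₁i
  have ha : c35 * (geo i).M * α₀ ≤ a₁ := by
    have h1 : (geo i).M * α₀ * c35 ≤ a₁ := (le_div_iff₀ hc).mp hMa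
    calc c35 * (geo i).M * α₀ = (geo i).M * α₀ * c35 := by ring
      _ ≤ a₁ := h1
  obtain ⟨hl, hi, hR, hf⟩ := h39 i hM₁i α₀ hα₀ ha U hU
  obtain ⟨h261a, h261b⟩ := h261 i hMLi
  refine ⟨?_, fun w y y' => ⟨locDep_EK39OfOps (𝔬 i) (rd i) d _ _ (hloc i) U w, ?_⟩⟩
  · exact conv348_of_local348 (𝔬 i) (R i) (H i) d r α' θ₀ B₀ δ₀ N U hr hrδ hα' hθ₀ hB₀.le hN hMpos hbig (hst i)
      h261b hl hi hR
  · exact kterm_EK39OfOps_le (𝔬 i) (rd i) (R i) (H i) d _ _ δ₀ α θ₀ B₀ N U hδ₀.le hα hα1.le hθ₀ hB₀.le hMpos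
      (hst i) h261a hl hf w y y'

end Family

/-! ## §5 The consumer face: «This theorem implies Theorem 3.2» — the kernel-summation leaf `B9.RWKernelSumYields` at the datum -/

section KernelSum

variable {g : B9.Geometry} [DecidableEq g.Site] {B : B9.Backgrounds} {ι κ : Type}

/-- **THE KERNEL LETTER OF THE CARRIERS READS THE INVERSE**: the site kernel `Cv` (the carrier field `Cinv` of the N06 bundle —
the kernel (Q′(U)G′²(U)Q′\*(U))⁻¹(y, y′) of Theorem 3.2) IS, at every U at which L(U) = Q′G′²Q′\* has a two-sided inverse T on the
functions on 𝔅, the kernel of T w.r.t. the pairing weight (L^{j′}η)^d.  (Two-sided inverses are unique, so the reading is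
consistent.)  A READING HYPOTHESIS relating the abstract carrier to the model operators, nothing asserted (pattern of
`B9Thm37GlueCor36.CoRealizes`). [cite: Balaban1985BackgroundPropagators, Thm 3.2 (3.48) p.398 + (3.96) p.411] -/
def KerReads (𝔬 : Ops39 g B ι κ) (Cv : B9.SiteKernel g B) (d : ℕ) : Prop :=
  ∀ (U : B.Cfg) (T : Module.End ℝ (g.Site → ℝ)), T * 𝔬.L U = 1 → 𝔬.L U * T = 1 →
    ∀ y y' : g.Site, Cv.ker U y y' = ker (vol g d) T y y'

end KernelSum

section FamilyKernelSum

variable {I : Type} {c35 : ℝ} {geo : I → B9.Geometry} {bg : I → B9.Backgrounds}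
variable [∀ i, DecidableEq (geo i).Site] {ι κ : I → Type}

/-- **«THIS THEOREM IMPLIES THEOREM 3.2» — the kernel-summation leaf from the pinned convergence reading.**  For ANY expansion data
`E` whose convergence predicate implies `Conv348 (𝔬 i) d B₁ δ₁` (with B₁, δ₁ > 0) and any carrier kernel `Cinv` READING the
inverse (`KerReads`): `B9.RWKernelSumYields d geo bg E Cinv` — convergence at U gives |Cinv(U)(y, y′)| ≦ B₁(L^jη)^{−4}(L^{j′}η)^{−d}
e^{−δ₁d(y,y′)}.  (The cell typed this step as a by-reference leaf; at the pinned reading it is bookkeeping.)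
[cite: Balaban1985BackgroundPropagators, Thm 3.9 ⇒ Thm 3.2 p.413 + (3.48) p.398] -/
theorem rwKernelSumYields_of_conv348 [∀ i, Fintype (ι i)] {E : ∀ i, B9.RWKernelExpansion (geo i) (bg i)}
    (𝔬 : ∀ i, Ops39 (geo i) (bg i) (ι i) (κ i)) (Cinv : ∀ i, B9.SiteKernel (geo i) (bg i)) (d : ℕ) {B₁ δ₁ : ℝ}
    (hB₁ : 0 < B₁) (hδ₁ : 0 < δ₁) (hE : ∀ (i : I) (U : (bg i).Cfg), (E i).Converges U → Conv348 (𝔬 i) d B₁ δ₁ U)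
    (hrd : ∀ i, KerReads (𝔬 i) (Cinv i) d) : B9.RWKernelSumYields d geo bg E Cinv := by
  refine ⟨B₁, δ₁, hB₁, hδ₁, fun i U hconv y y' => ?_⟩
  obtain ⟨T, hTL, hLT, hb⟩ := hE i U hconv
  rw [hrd i U T hTL hLT y y']
  exact hb y y'

/-- ★ **`hksum` AT THE PINNED DATUM**: `B9.RWKernelSumYields d geo bg (fun i => EK39OfOps (𝔬 i) (rd i) d B₁ δ₁) Cinv` for every
carrier kernel reading the inverse, B₁, δ₁ > 0 (`converges_EK39OfOps` is `Iff.rfl`). [cite: Balaban1985BackgroundPropagators, Thm 3.9 ⇒ Thm 3.2 p.413 + (3.48) p.398] -/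
theorem rwKernelSumYields_EK39OfOps [∀ i, Fintype (ι i)] (𝔬 : ∀ i, Ops39 (geo i) (bg i) (ι i) (κ i))
    (rd : ∀ i, WalkReading39 (bg i) (ι i) (κ i)) (Cinv : ∀ i, B9.SiteKernel (geo i) (bg i)) (d : ℕ) {B₁ δ₁ : ℝ}
    (hB₁ : 0 < B₁) (hδ₁ : 0 < δ₁) (hrd : ∀ i, KerReads (𝔬 i) (Cinv i) d) :
    B9.RWKernelSumYields d geo bg (fun i => EK39OfOps (𝔬 i) (rd i) d B₁ δ₁) Cinv :=
  rwKernelSumYields_of_conv348 𝔬 Cinv d hB₁ hδ₁ (fun _ _ h => h) hrd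

/-- **THEOREM 3.2 AS TYPED, from the two leaves at the datum** (p. 413: *"This theorem implies Theorem 3.2"* — the cell's
`B9.thm32_of_thm39`, kernel-checked bookkeeping): `B9.Thm39Printed` at `EK39OfOps … B₁ δ₁` (e.g. `thm39Printed_of_local348`) and a
carrier kernel reading the inverse give `B9.Thm32Printed d c35 geo bg Cinv`. [cite: Balaban1985BackgroundPropagators, Thm 3.9 ⇒ Thm 3.2 p.413 + Thm 3.2 (3.48) p.398] -/
theorem thm32Printed_EK39OfOps [∀ i, Fintype (ι i)] (𝔬 : ∀ i, Ops39 (geo i) (bg i) (ι i) (κ i))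
    (rd : ∀ i, WalkReading39 (bg i) (ι i) (κ i)) (Cinv : ∀ i, B9.SiteKernel (geo i) (bg i)) (d : ℕ) {B₁ δ₁ : ℝ}
    (hB₁ : 0 < B₁) (hδ₁ : 0 < δ₁) (hrd : ∀ i, KerReads (𝔬 i) (Cinv i) d)
    (h39 : B9.Thm39Printed d c35 geo bg (fun i => EK39OfOps (𝔬 i) (rd i) d B₁ δ₁)) :
    B9.Thm32Printed d c35 geo bg Cinv :=
  B9.thm32_of_thm39 d c35 geo bg _ Cinv h39 (rwKernelSumYields_EK39OfOps 𝔬 rd Cinv d hB₁ hδ₁ hrd)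

end FamilyKernelSum

/-! ## §6 (v1.1) The kernel-summation leaf WITHOUT a sign condition on the convergence constant

The knit at the record reads `hksum` at the datum of `thm39Printed_of_local348`, whose convergence constant is
B₁ = 2NB₀c₁(r, α′) with c₁ = `B6.c1` — nonnegative (`B6RandomWalk.c1_nonneg`) but with no positivity lemma in the tree
(c₀ is a `tsum`).  Since `B9.RWKernelSumYields` only asks for SOME positive constant, the bound at B₁ is weakened to
max(B₁, 1) under the sign facts of the geometry (L^jη > 0 — at the record `B6KLevelCensusIndexV1.len_pos`), so the
consumer owes `0 < δ₁` and the kernel reading only. -/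

section FamilyKernelSumLen

variable {I : Type} {c35 : ℝ} {geo : I → B9.Geometry} {bg : I → B9.Backgrounds}
variable [∀ i, DecidableEq (geo i).Site] {ι κ : I → Type}

/-- **`hksum` AT THE PINNED DATUM, no sign condition on B₁**: for every carrier kernel reading the inverse (`KerReads`), every
δ₁ > 0 and ANY B₁, `B9.RWKernelSumYields d geo bg (fun i => EK39OfOps (𝔬 i) (rd i) d B₁ δ₁) Cinv` — with the constant
max(B₁, 1), using L^jη > 0 (`hlen`) to weaken (3.48) at B₁ to (3.48) at max(B₁, 1).  (p. 413: *"This theorem implies Theorem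
3.2."*) [cite: Balaban1985BackgroundPropagators, Thm 3.9 ⇒ Thm 3.2 p.413 + (3.48) p.398] -/
theorem rwKernelSumYields_EK39OfOps_of_len [∀ i, Fintype (ι i)] (𝔬 : ∀ i, Ops39 (geo i) (bg i) (ι i) (κ i))
    (rd : ∀ i, WalkReading39 (bg i) (ι i) (κ i)) (Cinv : ∀ i, B9.SiteKernel (geo i) (bg i)) (d : ℕ) {B₁ δ₁ : ℝ}
    (hδ₁ : 0 < δ₁) (hlen : ∀ (i : I) (y : (geo i).Site), 0 < (geo i).len y) (hrd : ∀ i, KerReads (𝔬 i) (Cinv i) d) :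
    B9.RWKernelSumYields d geo bg (fun i => EK39OfOps (𝔬 i) (rd i) d B₁ δ₁) Cinv := by
  refine rwKernelSumYields_of_conv348 𝔬 Cinv d (lt_max_of_lt_right one_pos : (0 : ℝ) < max B₁ 1) hδ₁
    (fun i U h => ?_) hrd
  obtain ⟨T, hTL, hLT, hb⟩ := h
  refine ⟨T, hTL, hLT, fun y y' => (hb y y').trans ?_⟩
  have hrest : 0 ≤ (geo i).len y ^ (-(4 : ℝ)) * (geo i).len y' ^ (-(d : ℝ)) * Real.exp (-(δ₁ * (geo i).dist y y')) :=
    mul_nonneg (mul_nonneg (Real.rpow_nonneg (hlen i y).le _) (Real.rpow_nonneg (hlen i y').le _)) (Real.exp_nonneg _)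
  calc B₁ * (geo i).len y ^ (-(4 : ℝ)) * (geo i).len y' ^ (-(d : ℝ)) * Real.exp (-(δ₁ * (geo i).dist y y'))
      = B₁ * ((geo i).len y ^ (-(4 : ℝ)) * (geo i).len y' ^ (-(d : ℝ)) * Real.exp (-(δ₁ * (geo i).dist y y'))) := by ring
    _ ≤ max B₁ 1 * ((geo i).len y ^ (-(4 : ℝ)) * (geo i).len y' ^ (-(d : ℝ)) * Real.exp (-(δ₁ * (geo i).dist y y'))) :=
        mul_le_mul_of_nonneg_right (le_max_left B₁ 1) hrest
    _ = _ := by ring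

/-- **THEOREM 3.2 AS TYPED from the Theorem-3.9 leaf at the datum, no sign condition on B₁** (`B9.thm32_of_thm39` with
`rwKernelSumYields_EK39OfOps_of_len`). [cite: Balaban1985BackgroundPropagators, Thm 3.9 ⇒ Thm 3.2 p.413 + Thm 3.2 (3.48) p.398] -/
theorem thm32Printed_EK39OfOps_of_len [∀ i, Fintype (ι i)] (𝔬 : ∀ i, Ops39 (geo i) (bg i) (ι i) (κ i))
    (rd : ∀ i, WalkReading39 (bg i) (ι i) (κ i)) (Cinv : ∀ i, B9.SiteKernel (geo i) (bg i)) (d : ℕ) {B₁ δ₁ : ℝ}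
    (hδ₁ : 0 < δ₁) (hlen : ∀ (i : I) (y : (geo i).Site), 0 < (geo i).len y) (hrd : ∀ i, KerReads (𝔬 i) (Cinv i) d)
    (h39 : B9.Thm39Printed d c35 geo bg (fun i => EK39OfOps (𝔬 i) (rd i) d B₁ δ₁)) :
    B9.Thm32Printed d c35 geo bg Cinv :=
  B9.thm32_of_thm39 d c35 geo bg _ Cinv h39 (rwKernelSumYields_EK39OfOps_of_len 𝔬 rd Cinv d hδ₁ hlen hrd)

end FamilyKernelSumLen

end

end Literature.MathematicalPhysics.QuantumFieldTheory.Balaban1983to89.B9Thm39Whole
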